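import Literature.RingTheory.MvPowerSeries.MonoidPowerSeriesFaceRestrict
import HarnessLib

/-!
# The dimension bound `dim R⟦P⟧ ≤ dim R + rank P` for completed monoid algebras

`Literature/RingTheory/MvPowerSeries/MonoidPowerSeriesDimension.lean`. K. Kato, *Toric
singularities*, Amer. J. Math. 116 (1994), §3 uses `dim R[[P]][[T₁, …, T_r]] = dim R + dim P + r`
for a complete regular local `R` and a fine sharp monoid `P` (proof of (3.2)); Gabber–Ramero,
§6.5, Prop. 6.5.3: `dim S_P⁻¹A[P] = dim A + dim P`. We PROVE the inequality that the structure
theorem needs, for `R⟦P⟧ = monoidPowerSeries R P` (`P ⊆ ℕ^{(σ)}` finitely generated, `σ` finite,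
`R` Noetherian local):

  `ringKrullDim R⟦P⟧ ≤ ringKrullDim R + rank P`   (`monoidPowerSeries.ringKrullDim_le`).

Proof (induction on `rank P` through the FACES of `P`): for `P ≠ 0` let `x₀ = x^{p₀}`, `p₀` the
sum of the generators. By Krull, `dim R⟦P⟧ ≤ dim (R⟦P⟧/x₀) + 1`. A prime `𝔓 ∋ x₀` determines
the proper face `F(𝔓) = {q ∈ P | x^q ∉ 𝔓}` (`primeFace`, `p₀ ∉ F(𝔓)`), and `𝔓` contains the
kernel of the restriction `R⟦P⟧ → R⟦F(𝔓)⟧` (`ker_faceRestrict_primeFace_le`). Hence a chain of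
primes above `x₀` is a chain of primes of `R⟦F⟧ ≅ R⟦P⟧/ker` for the proper face `F = F(𝔓₀)` of
its bottom, of length `≤ dim R + rank F ≤ dim R + rank P − 1` by induction (`rank_lt_of_isFace`).

References: [Kato1994] K. Kato, Toric singularities, Amer. J. Math. 116 (1994), §3 (proof of
(3.2)), §5; Gabber–Ramero, Foundations for almost ring theory, arXiv:math/0409584, Prop. 6.5.3.
-/

noncomputable section

open MvPowerSeries Pointwise

namespace Literature.RingTheory.MvPowerSeries

namespace monoidPowerSeries

universe u v

variable {σ : Type u} {R : Type v} [CommRing R]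

/-! ### The dimension bound -/

/-- The zero monoid is a face of every `P ⊆ ℕ^{(σ)}`. [cite: Kato1994, (5.1)–(5.3)] -/
theorem isFace_bot (P : AddSubmonoid (σ →₀ ℕ)) : IsFace ⊥ P :=
  ⟨bot_le, fun a _ b _ hab => by
    rw [AddSubmonoid.mem_bot] at hab ⊢
    exact (add_eq_zero.1 hab).1⟩

/-- `R⟦0⟧ ≅ R`: a series supported on the zero monoid is its constant term. [cite: Kato1994, §3] -/
def botEquiv : monoidPowerSeries R (⊥ : AddSubmonoid (σ →₀ ℕ)) ≃+* R :=
  RingEquiv.ofBijective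
    ((MvPowerSeries.constantCoeff (σ := σ) (R := R)).comp (monoidPowerSeries R ⊥).val.toRingHom)
    (by
      classical
      constructor
      · intro f g hfg
        refine Subtype.ext ?_
        ext e
        by_cases he : e = 0
        · subst he
          simpa [MvPowerSeries.coeff_zero_eq_constantCoeff] using hfg
        · have he' : e ∉ (⊥ : AddSubmonoid (σ →₀ ℕ)) := he
          rw [f.2 e he', g.2 e he']
      · intro r
        exact ⟨⟨MvPowerSeries.C r, C_mem r⟩, by simp⟩)

set_option synthInstance.maxHeartbeats 200000 in
/-- **Kato 1994, §3 / Gabber–Ramero Prop. 6.5.3 (inequality): `dim R⟦P⟧ ≤ dim R + rank P`**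
for `R` Noetherian local and `P ⊆ ℕ^{(σ)}` finitely generated (`σ` finite).
[cite: Kato1994, §3 (proof of (3.2))] -/
theorem ringKrullDim_le [IsNoetherianRing R] [IsLocalRing R] [Finite σ]
    {P : AddSubmonoid (σ →₀ ℕ)} (hP : P.FG) :
    ringKrullDim (monoidPowerSeries R P) ≤ ringKrullDim R + rank P := by
  classical
  -- strong induction on the rank
  suffices H : ∀ (n : ℕ) (Q : AddSubmonoid (σ →₀ ℕ)), Q.FG → rank Q = n →
      ringKrullDim (monoidPowerSeries R Q) ≤ ringKrullDim R + n from H _ P hP rfl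
  intro n
  induction n using Nat.strong_induction_on with
  | _ n ih =>
    intro Q hQ hQn
    obtain ⟨m, g, hg0, hgQ⟩ : ∃ (m : ℕ) (g : Fin m → (σ →₀ ℕ)), (∀ i, g i ≠ 0) ∧
        AddSubmonoid.closure (Set.range g) = Q := by
      obtain ⟨S, hS⟩ := hQ
      let S' := S.filter (· ≠ 0)
      refine ⟨S'.card, fun i => (S'.equivFin.symm i : σ →₀ ℕ), fun i => ?_, ?_⟩
      · have h := (S'.equivFin.symm i).2
        simp only [S', Finset.mem_filter] at h
        exact h.2
      · rw [← hS]
        refine le_antisymm (AddSubmonoid.closure_le.2 ?_) (AddSubmonoid.closure_le.2 fun x hx => ?_)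
        · rintro _ ⟨i, rfl⟩
          have h := (S'.equivFin.symm i).2
          simp only [S', Finset.mem_filter] at h
          exact AddSubmonoid.subset_closure h.1
        · by_cases hx0 : x = 0
          · rw [hx0]; exact AddSubmonoid.zero_mem _
          · have hx' : x ∈ S' := by simp only [S', Finset.mem_filter]; exact ⟨hx, hx0⟩
            exact AddSubmonoid.subset_closure ⟨S'.equivFin ⟨x, hx'⟩, by simp⟩
    haveI : IsNoetherianRing (monoidPowerSeries R Q) := isNoetherianRing hQ
    haveI : IsLocalRing (monoidPowerSeries R Q) := isLocalRing
    rcases Nat.eq_zero_or_pos m with hm | hm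
    · -- no generators: `Q = ⊥`, `R⟦Q⟧ ≅ R`
      subst hm
      have hQbot : Q = ⊥ := by
        rw [← hgQ, Set.range_eq_empty, AddSubmonoid.closure_empty]
      subst hQbot
      rw [ringKrullDim_eq_of_ringEquiv (botEquiv (σ := σ) (R := R)), ← hQn, rank_bot,
        Nat.cast_zero, add_zero]
    · -- `p₀ = ∑ gᵢ`, `x₀ = x^{p₀}` lies in the maximal ideal
      set p₀ : σ →₀ ℕ := ∑ i, g i with hp₀
      have hp₀Q : p₀ ∈ Q := hgQ ▸ AddSubmonoid.sum_mem _ fun i _ =>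
        AddSubmonoid.subset_closure ⟨i, rfl⟩
      have hp₀ne : p₀ ≠ 0 := by
        intro h0
        have : g ⟨0, hm⟩ ≤ p₀ := Finset.single_le_sum (fun _ _ => zero_le)
          (Finset.mem_univ (⟨0, hm⟩ : Fin m))
        rw [h0, nonpos_iff_eq_zero] at this
        exact hg0 _ this
      set x₀ : monoidPowerSeries R Q := ⟨MvPowerSeries.monomial p₀ (1 : R), monomial_mem hp₀Q 1⟩
        with hx₀
      have hx₀max : x₀ ∈ IsLocalRing.maximalIdeal (monoidPowerSeries R Q) := by
        rw [mem_maximalIdeal_iff, Subtype.coe_mk, ← MvPowerSeries.coeff_zero_eq_constantCoeff_apply,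
          MvPowerSeries.coeff_monomial, if_neg (Ne.symm hp₀ne)]
        exact Ideal.zero_mem _
      -- every quotient by an ideal containing `x₀` has dimension `≤ dim R + (n - 1)`
      have key : ∀ J : Ideal (monoidPowerSeries R Q), x₀ ∈ J →
          ringKrullDim (monoidPowerSeries R Q ⧸ J) ≤ ringKrullDim R + (n - 1 : ℕ) := by
        intro J hx₀J
        rw [ringKrullDim_quotient, Order.krullDim]
        refine iSup_le fun s => ?_
        -- the bottom prime of the chain and its face
        let 𝔓₀ : Ideal (monoidPowerSeries R Q) := (s 0).1.asIdeal
        haveI : 𝔓₀.IsPrime := (s 0).1.2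
        have hx₀mem : x₀ ∈ 𝔓₀ := (PrimeSpectrum.mem_zeroLocus _ _).1 (s 0).2 hx₀J
        have hF : IsFace (primeFace (R := R) 𝔓₀) Q := isFace_primeFace 𝔓₀
        have hp₀F : p₀ ∉ primeFace (R := R) 𝔓₀ := fun h =>
          ((mem_primeFace_iff 𝔓₀ hp₀Q).1 h) hx₀mem
        have hrank : rank (primeFace (R := R) 𝔓₀) < n := hQn ▸ rank_lt_of_isFace hF hp₀Q hp₀F
        -- the chain lives in `Spec (D ⧸ ker res_F) ≅ Spec D_F`
        have hK𝔓 : RingHom.ker (faceRestrict (R := R) hF).toRingHom ≤ 𝔓₀ :=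
          ker_faceRestrict_primeFace_le hQ 𝔓₀
        have hstep : ∀ i : Fin (s.length + 1),
            RingHom.ker (faceRestrict (R := R) hF).toRingHom ≤ (s i).1.asIdeal := fun i =>
          hK𝔓.trans (show (s 0).1 ≤ (s i).1 from s.monotone (Fin.zero_le i))
        let s' : LTSeries (PrimeSpectrum.zeroLocus (R := monoidPowerSeries R Q)
            (RingHom.ker (faceRestrict (R := R) hF).toRingHom)) :=
          { length := s.length
            toFun := fun i => ⟨(s i).1, hstep i⟩
            step := fun i => s.step i }
        have hlen : (s.length : WithBot ℕ∞) = s'.length := rfl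
        rw [hlen]
        refine (Order.LTSeries.length_le_krullDim s').trans ?_
        rw [← ringKrullDim_quotient,
          ringKrullDim_eq_of_ringEquiv (RingHom.quotientKerEquivOfSurjective
            (f := (faceRestrict (R := R) hF).toRingHom) (faceRestrict_surjective hF))]
        refine (ih _ hrank _ (hF.fg hQ) rfl).trans ?_
        exact add_le_add le_rfl
          (by exact_mod_cast (show rank (primeFace (R := R) 𝔓₀) ≤ n - 1 by omega))
      -- Krull: `dim D ≤ dim D/x₀ + 1`
      refine (ringKrullDim_le_ringKrullDim_quotSMulTop_succ hx₀max).trans ?_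
      refine (add_le_add (key _ ?_) (le_refl (1 : WithBot ℕ∞))).trans ?_
      · have h1 := Submodule.smul_mem_pointwise_smul (1 : monoidPowerSeries R Q) x₀
          (⊤ : Ideal (monoidPowerSeries R Q)) Submodule.mem_top
        rwa [smul_eq_mul, mul_one] at h1
      have hn : 1 ≤ n := by
        have h := rank_lt_of_isFace (isFace_bot Q) hp₀Q
          (show p₀ ∉ (⊥ : AddSubmonoid (σ →₀ ℕ)) from hp₀ne)
        rw [hQn] at h
        omega
      have heq : ringKrullDim R + ((n - 1 : ℕ) : WithBot ℕ∞) + 1 =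
          ringKrullDim R + (n : WithBot ℕ∞) := by
        rw [add_assoc]
        congr 1
        have : ((n - 1 : ℕ) : WithBot ℕ∞) + 1 = ((n - 1 + 1 : ℕ) : WithBot ℕ∞) := by push_cast; rfl
        rw [this, Nat.sub_add_cancel hn]
      rw [heq]

end monoidPowerSeries

end Literature.RingTheory.MvPowerSeries
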